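import Literature.Dynamics.SymbolicDynamics.Hochman2025Certificates
import Literature.Dynamics.SymbolicDynamics.Hochman2025Outer
import Literature.Dynamics.SymbolicDynamics.Hochman2025Membrane
import Mathlib.Analysis.Convex.Topology
import HarnessLib

/-!
# Hochman 2025, §6.2: zones of the gluing, free sites, and large gap continua

Set-up of the gluing theorem (§6 of M. Hochman, *Irreducibility and periodicity in `ℤ²`
symbolic systems*, Discrete Analysis 2025:17) for a finite `20`-chain-connected `J ⊆ ℤ²`
(the set along which `y` is glued) and the *outer far region* `Outer 20 J` of
`Hochman2025Outer.lean` (where `x` is glued). Hochman (§6.2) fattens `E_y = J` and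
`E_x` into open zones `Ê_y, Ê_x` and calls `Ê = ℝ² ∖ (Ê_x ∪ Ê_y)` the *gap*. We use instead the
continuous `1`-Lipschitz function `β = d_∞(·, Outer 20 J)` (sup-distance, in `ℂ ≅ ℝ²`, to the
outer sites viewed as points) and put

* `U J = {β < 21/2}` (the `x`-zone), `V J = {β > 21/2}` (the `y`-zone), `Gap J = {β = 21/2}`.

Then (`Hochman2025.Gluing` namespace):

* the zones are open and disjoint and the gap is their closed complement, so a connected set
  missing the gap lies in one zone (`subset_U_or_V`);
* **free sites**: the lattice site `[p]` of a point with `1 ≤ β p < 20` — in particular of a gap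
  point — is neither in `J` nor in `Outer 20 J` (`site_not_mem_of_β_lt`,
  `site_not_mem_outer_of_one_le_β`), so the glued configuration is unconstrained there;
  dually `α = d_∞(·, (Outer 20 J)ᶜ)` measures depth into the `x`-zone, `1 ≤ α p` forces
  `[p] ∈ Outer 20 J` and `β p < 1`, and deep points of the two kinds are far apart
  (`norm_sub_gt_of_α_β`);
* **polylines of chains** (`polyline`): the broken line through the points of a `g`-chain of
  sites is connected and stays within sup-distance `g/2` of the chain; the polyline of a chain of
  outer sites lies in `U`, that of a chain of sites of `J` in `V`;
* **reach**: from every outer site there is a connected subset of `U` reaching arbitrarily far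
  (`exists_U_reach`), and from every site of `J` a connected subset of `V` reaching distance
  `≥ diam(J)/2` (`exists_V_reach`);
* **large gap continua** (`exists_gap_continuum`): by the membrane lemma
  (`Hochman2025Membrane.lean`), around EVERY gap point `e` the gap contains a compact connected
  set spanning the annulus `50 ≤ |z - e| ≤ R` whenever `diam J ≥ 2R + 130` — the rigorous form
  of "`Ê ∩ F` has a connected component `Ê′` with diameter at least `rₙ/10`" (§6.3 Step C).

## References

* [Hochman2025] M. Hochman, *Irreducibility and periodicity in `ℤ²` symbolic systems*, Discrete
  Analysis 2025:17, §6.2 (zones, gap) and §6.3 Step C. Read via `lit read arxiv:2401.02273`.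
-/

noncomputable section

open Set Metric

namespace Literature.Dynamics.SymbolicDynamics

namespace Hochman2025

namespace Gluing

/-! ### The sup norm on `ℂ`, sites as points, sup-distance to a set of sites -/

/-- The sup norm on `ℂ ≅ ℝ²`. [folklore] -/
def supNorm (z : ℂ) : ℝ := max |z.re| |z.im|

/-- `supNorm` is nonnegative. [folklore] -/
theorem supNorm_nonneg (z : ℂ) : 0 ≤ supNorm z := le_max_of_le_left (abs_nonneg _)

/-- Triangle inequality. [folklore] -/
theorem supNorm_add_le (z w : ℂ) : supNorm (z + w) ≤ supNorm z + supNorm w := by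
  unfold supNorm
  have h1 := abs_add_le z.re w.re
  have h2 := abs_add_le z.im w.im
  simp only [Complex.add_re, Complex.add_im]
  rcases le_total |z.re| |z.im| with h | h <;> rcases le_total |w.re| |w.im| with h' | h' <;>
    simp only [max_eq_right h, max_eq_left h, max_eq_right h', max_eq_left h', max_le_iff] <;>
    constructor <;> linarith

/-- Triangle inequality for differences. [folklore] -/
theorem supNorm_sub_le (p q r : ℂ) : supNorm (p - r) ≤ supNorm (p - q) + supNorm (q - r) := by
  have := supNorm_add_le (p - q) (q - r); rwa [sub_add_sub_cancel] at this

/-- `supNorm (-z) = supNorm z`. [folklore] -/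
@[simp] theorem supNorm_neg (z : ℂ) : supNorm (-z) = supNorm z := by simp [supNorm, abs_neg]

/-- `supNorm 0 = 0`. [folklore] -/
@[simp] theorem supNorm_zero : supNorm 0 = 0 := by simp [supNorm]

/-- Symmetry of the sup distance. [folklore] -/
theorem supNorm_sub_comm (z w : ℂ) : supNorm (z - w) = supNorm (w - z) := by
  rw [← supNorm_neg, neg_sub]

/-- Homogeneity for real scalars. [folklore] -/
theorem supNorm_real_smul (t : ℝ) (z : ℂ) : supNorm ((t : ℂ) * z) = |t| * supNorm z := by
  unfold supNorm
  simp only [Complex.re_ofReal_mul, Complex.im_ofReal_mul, abs_mul]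
  exact (mul_max_of_nonneg _ _ (abs_nonneg t)).symm

/-- The sup norm is dominated by the Euclidean norm. [folklore] -/
theorem supNorm_le_norm (z : ℂ) : supNorm z ≤ ‖z‖ :=
  max_le (Complex.abs_re_le_norm z) (Complex.abs_im_le_norm z)

/-- The Euclidean norm is at most twice the sup norm. [folklore] -/
theorem norm_le_two_mul_supNorm (z : ℂ) : ‖z‖ ≤ 2 * supNorm z := by
  have := Complex.norm_le_abs_re_add_abs_im z
  have h1 : |z.re| ≤ supNorm z := le_max_left _ _
  have h2 : |z.im| ≤ supNorm z := le_max_right _ _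
  linarith

/-- Coordinates are bounded by the sup norm. [folklore] -/
theorem abs_re_le_supNorm (z : ℂ) : |z.re| ≤ supNorm z := le_max_left _ _

/-- Coordinates are bounded by the sup norm. [folklore] -/
theorem abs_im_le_supNorm (z : ℂ) : |z.im| ≤ supNorm z := le_max_right _ _

/-- A site as a point of the plane. [folklore] -/
def pt (u : ℤ × ℤ) : ℂ := (u.1 : ℂ) + (u.2 : ℂ) * Complex.I

/-- Real part of a site point. [folklore] -/
@[simp] theorem pt_re (u : ℤ × ℤ) : (pt u).re = u.1 := by simp [pt]
/-- Imaginary part of a site point. [folklore] -/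
@[simp] theorem pt_im (u : ℤ × ℤ) : (pt u).im = u.2 := by simp [pt]

/-- The sup distance of two sites is their lattice distance. [folklore] -/
theorem supNorm_pt_sub_pt (u v : ℤ × ℤ) : supNorm (pt u - pt v) = ldist u v := by
  have := dist_eq_ldist u v
  rw [Prod.dist_eq, Int.dist_eq, Int.dist_eq] at this
  simp only [supNorm, Complex.sub_re, Complex.sub_im, pt_re, pt_im]
  exact this

/-- A point is within sup distance `< 1` of its site. [folklore] -/
theorem supNorm_sub_site_lt (p : ℂ) : supNorm (p - pt (Plane.site p)) < 1 := by
  simp only [supNorm, Complex.sub_re, Complex.sub_im, pt_re, pt_im, Plane.site, max_lt_iff]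
  have a1 := Int.floor_le p.re; have a2 := Int.lt_floor_add_one p.re
  have b1 := Int.floor_le p.im; have b2 := Int.lt_floor_add_one p.im
  constructor <;> (rw [abs_lt]; constructor <;> linarith)

/-- The site of a site. [folklore] -/
@[simp] theorem site_pt (u : ℤ × ℤ) : Plane.site (pt u) = u := by
  simp [Plane.site, pt]

/-- Sites of nearby points are nearby: `ldist [p] u < supNorm (p - u) + 1`. [folklore] -/
theorem ldist_site_lt (p : ℂ) (u : ℤ × ℤ) : (ldist (Plane.site p) u : ℝ) < supNorm (p - pt u) + 1 := by
  rw [← supNorm_pt_sub_pt]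
  have h1 := supNorm_sub_le (pt (Plane.site p)) p (pt u)
  have h2 := supNorm_sub_site_lt p
  rw [supNorm_sub_comm] at h2
  linarith

variable (A : Set (ℤ × ℤ))

/-- **Sup distance to a set of sites.** [folklore] -/
def sdist (p : ℂ) : ℝ := ⨅ u : A, supNorm (p - pt u)

variable {A}

/-- The defining family is bounded below. [folklore] -/
theorem sdist_bddBelow (p : ℂ) : BddBelow (Set.range fun u : A => supNorm (p - pt u)) :=
  ⟨0, by rintro _ ⟨u, rfl⟩; exact supNorm_nonneg _⟩

/-- `sdist` is a lower bound. [folklore] -/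
theorem sdist_le {p : ℂ} {u : ℤ × ℤ} (hu : u ∈ A) : sdist A p ≤ supNorm (p - pt u) :=
  ciInf_le (sdist_bddBelow p) ⟨u, hu⟩

/-- `sdist` is nonnegative. [folklore] -/
theorem sdist_nonneg (hA : A.Nonempty) (p : ℂ) : 0 ≤ sdist A p := by
  haveI : Nonempty A := hA.to_subtype
  exact le_ciInf fun u => supNorm_nonneg _

/-- Lower bounds transfer to `sdist`. [folklore] -/
theorem le_sdist (hA : A.Nonempty) {p : ℂ} {t : ℝ} (h : ∀ u ∈ A, t ≤ supNorm (p - pt u)) :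
    t ≤ sdist A p := by
  haveI : Nonempty A := hA.to_subtype
  exact le_ciInf fun u => h u u.2

/-- Approximation: if `sdist A p < t` there is a site of `A` within `t`. [folklore] -/
theorem exists_lt_of_sdist_lt (hA : A.Nonempty) {p : ℂ} {t : ℝ} (h : sdist A p < t) :
    ∃ u ∈ A, supNorm (p - pt u) < t := by
  haveI : Nonempty A := hA.to_subtype
  obtain ⟨u, hu⟩ := exists_lt_of_ciInf_lt h
  exact ⟨u, u.2, hu⟩

/-- **`sdist` is `1`-Lipschitz for the sup norm.** [folklore] -/
theorem sdist_le_sdist_add (hA : A.Nonempty) (p q : ℂ) : sdist A p ≤ sdist A q + supNorm (p - q) := by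
  by_contra hlt
  push Not at hlt
  have : sdist A q < sdist A p - supNorm (p - q) := by linarith
  obtain ⟨u, hu, hlt'⟩ := exists_lt_of_sdist_lt hA this
  have h1 := sdist_le (p := p) hu
  have h2 := supNorm_sub_le p q (pt u)
  linarith

/-- `sdist` is `1`-Lipschitz for the Euclidean distance. [folklore] -/
theorem lipschitz_sdist (hA : A.Nonempty) : LipschitzWith 1 (sdist A) := by
  refine LipschitzWith.of_le_add fun p q => ?_
  have h1 := sdist_le_sdist_add hA p q
  have h2 := supNorm_le_norm (p - q)
  rw [Complex.dist_eq]
  linarith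

/-- Differences of `sdist` are bounded by the Euclidean distance. [folklore] -/
theorem abs_sdist_sub_le (hA : A.Nonempty) (p q : ℂ) : |sdist A p - sdist A q| ≤ ‖p - q‖ := by
  have h1 := sdist_le_sdist_add hA p q
  have h2 := sdist_le_sdist_add hA q p
  rw [supNorm_sub_comm] at h2
  have h3 := supNorm_le_norm (p - q)
  rw [abs_le]; constructor <;> linarith

/-- `sdist` is continuous. [folklore] -/
theorem continuous_sdist (hA : A.Nonempty) : Continuous (sdist A) := (lipschitz_sdist hA).continuous

/-- `sdist` is `< 1` at points whose site lies in `A`. [folklore] -/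
theorem sdist_lt_one_of_site_mem {p : ℂ} (h : Plane.site p ∈ A) : sdist A p < 1 :=
  lt_of_le_of_lt (sdist_le h) (supNorm_sub_site_lt p)

/-- **The site of a point at `sdist ≥ 1` from `A` is not in `A`.** [folklore] -/
theorem site_notMem_of_one_le_sdist {p : ℂ} (h : 1 ≤ sdist A p) : Plane.site p ∉ A :=
  fun hmem => absurd (sdist_lt_one_of_site_mem hmem) (not_lt.mpr h)

/-! ### The zones of the gluing (§6.2): `β`, `α`, `U`, `V`, `Gap` -/

variable (J : Finset (ℤ × ℤ))

/-- Depth into the `y`-side: sup-distance to the outer far region (gap `20`).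
[cite: Hochman2025, §6.2 (the zones)] -/
def β (p : ℂ) : ℝ := sdist (Outer 20 J) p

/-- Depth into the `x`-side: sup-distance to the complement of the outer far region.
[cite: Hochman2025, §6.2 (the zones)] -/
def α (p : ℂ) : ℝ := sdist (Outer 20 J)ᶜ p

/-- The `x`-zone `{β < 21/2}` (Hochman's `Ê_x`). [cite: Hochman2025, §6.2] -/
def U : Set ℂ := {p | β J p < 21 / 2}

/-- The `y`-zone `{β > 21/2}` (Hochman's `Ê_y`). [cite: Hochman2025, §6.2] -/
def V : Set ℂ := {p | 21 / 2 < β J p}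

/-- The gap `{β = 21/2}` (Hochman's `Ê`). [cite: Hochman2025, §6.2] -/
def Gap : Set ℂ := {p | β J p = 21 / 2}

variable {J}

/-- The outer region is non-empty (an escaping site exists). [folklore] -/
theorem outer_nonempty (hJ : J.Nonempty) : (Outer 20 J).Nonempty :=
  ⟨(minFst J hJ - 21, 0), Escapes.mem_outer fun q hq => by have := minFst_le hJ hq; simp; omega⟩

/-- The complement of the outer region is non-empty (it contains `J`). [folklore] -/
theorem compl_outer_nonempty (hJ : J.Nonempty) : (Outer 20 J)ᶜ.Nonempty := by
  obtain ⟨q, hq⟩ := hJ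
  exact ⟨q, not_mem_outer_of_mem hq⟩

/-- `β` is continuous. [folklore] -/
theorem continuous_β (hJ : J.Nonempty) : Continuous (β J) := continuous_sdist (outer_nonempty hJ)

/-- `α` is continuous. [folklore] -/
theorem continuous_α (hJ : J.Nonempty) : Continuous (α J) := continuous_sdist (compl_outer_nonempty hJ)

/-- `β` is `1`-Lipschitz. [folklore] -/
theorem abs_β_sub_le (hJ : J.Nonempty) (p q : ℂ) : |β J p - β J q| ≤ ‖p - q‖ :=
  abs_sdist_sub_le (outer_nonempty hJ) p q

/-- `α` is `1`-Lipschitz. [folklore] -/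
theorem abs_α_sub_le (hJ : J.Nonempty) (p q : ℂ) : |α J p - α J q| ≤ ‖p - q‖ :=
  abs_sdist_sub_le (compl_outer_nonempty hJ) p q

/-- `β ≥ 0`. [folklore] -/
theorem β_nonneg (hJ : J.Nonempty) (p : ℂ) : 0 ≤ β J p := sdist_nonneg (outer_nonempty hJ) p

/-- The `x`-zone is open. [folklore] -/
theorem isOpen_U (hJ : J.Nonempty) : IsOpen (U J) := isOpen_lt (continuous_β hJ) continuous_const

/-- The `y`-zone is open. [folklore] -/
theorem isOpen_V (hJ : J.Nonempty) : IsOpen (V J) := isOpen_lt continuous_const (continuous_β hJ)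

/-- The gap is closed. [folklore] -/
theorem isClosed_gap (hJ : J.Nonempty) : IsClosed (Gap J) := isClosed_eq (continuous_β hJ) continuous_const

/-- The zones are disjoint. [folklore] -/
theorem disjoint_U_V : Disjoint (U J) (V J) := by
  rw [Set.disjoint_left]
  intro p h1 h2
  simp only [U, V, mem_setOf_eq] at h1 h2
  linarith

/-- The gap is the complement of the two zones. [cite: Hochman2025, §6.2 (`Ê = ℝ² ∖ (Ê_x ∪ Ê_y)`)] -/
theorem compl_U_union_V : (U J ∪ V J)ᶜ = Gap J := by
  ext p
  simp only [mem_compl_iff, mem_union, U, V, Gap, mem_setOf_eq, not_or, not_lt]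
  constructor
  · rintro ⟨h1, h2⟩; linarith
  · intro h; rw [h]; exact ⟨le_rfl, le_rfl⟩

/-- **The gap separates the zones**: a preconnected set missing the gap lies in one zone.
[cite: Hochman2025, §6.2 ("`Ê` separates `E_x` from `E_y`")] -/
theorem subset_U_or_V (hJ : J.Nonempty) {S : Set ℂ} (hS : IsPreconnected S)
    (hgap : Disjoint S (Gap J)) : S ⊆ U J ∨ S ⊆ V J := by
  apply hS.subset_or_subset (isOpen_U hJ) (isOpen_V hJ) disjoint_U_V
  intro p hp
  by_contra h
  have : p ∈ (U J ∪ V J)ᶜ := h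
  rw [compl_U_union_V] at this
  exact Set.disjoint_left.mp hgap hp this

/-! ### Free sites -/

/-- Outer sites are far from `J`: `ldist o q ≥ 21`. [folklore] -/
theorem ldist_ge_of_outer {o q : ℤ × ℤ} (ho : o ∈ Outer 20 J) (hq : q ∈ J) : 21 ≤ ldist o q :=
  mem_far_iff.mp (outer_subset_far ho) q hq

/-- **`1 ≤ β p` ⇒ the site of `p` is not outer** (so `z` need not equal `x` there).
[cite: Hochman2025, §6.2–6.3 (witnesses in `Ê ∪ Ê_y`)] -/
theorem site_not_mem_outer_of_one_le_β {p : ℂ} (h : 1 ≤ β J p) : Plane.site p ∉ Outer 20 J :=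
  site_notMem_of_one_le_sdist h

/-- **`β p < 20` ⇒ the site of `p` is not in `J`** (so `z` need not equal `y` there).
[cite: Hochman2025, §6.2–6.3 (witnesses in `Ê ∪ Ê_x`)] -/
theorem site_not_mem_of_β_lt (hJ : J.Nonempty) {p : ℂ} (h : β J p < 20) : Plane.site p ∉ J := by
  intro hmem
  obtain ⟨o, ho, hlt⟩ := exists_lt_of_sdist_lt (outer_nonempty hJ) h
  have h1 := ldist_site_lt p o
  have h2 := ldist_ge_of_outer ho hmem
  rw [ldist_comm] at h2
  have : (21 : ℝ) ≤ ldist (Plane.site p) o := by exact_mod_cast h2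
  linarith

/-- The site of a point with `1 ≤ β p < 20` is not even far (it is within `20` of `J`).
[folklore] -/
theorem site_not_mem_far_of_β (hJ : J.Nonempty) {p : ℂ} (h1 : 1 ≤ β J p) (h20 : β J p < 20) :
    Plane.site p ∉ Far 20 J := by
  intro hfar
  obtain ⟨o, ho, hlt⟩ := exists_lt_of_sdist_lt (outer_nonempty hJ) h20
  have hd := ldist_site_lt p o
  have hle : ldist (Plane.site p) o ≤ 20 := by
    have : (ldist (Plane.site p) o : ℝ) < 21 := by linarith
    exact_mod_cast Nat.lt_succ_iff.mp (by exact_mod_cast this)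
  have hstep : Relation.ReflTransGen (ChainRel 20 (Far 20 J)) (Plane.site p) o :=
    Relation.ReflTransGen.single ⟨hfar, outer_subset_far ho, (dist_le_iff 20 _ _).mpr hle⟩
  exact site_not_mem_outer_of_one_le_β h1 (mem_outer_of_reflTransGen hstep ho)

/-- Near a point with `1 ≤ β p < 20` there is a site of `J` (within sup-distance `21`).
[folklore] -/
theorem exists_mem_near_of_β (hJ : J.Nonempty) {p : ℂ} (h1 : 1 ≤ β J p) (h20 : β J p < 20) :
    ∃ f ∈ J, supNorm (p - pt f) < 21 := by
  have hnf := site_not_mem_far_of_β hJ h1 h20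
  rw [mem_far_iff] at hnf
  push Not at hnf
  obtain ⟨f, hf, hle⟩ := hnf
  refine ⟨f, hf, ?_⟩
  have h1 := supNorm_sub_le p (pt (Plane.site p)) (pt f)
  have h2 := supNorm_sub_site_lt p
  rw [supNorm_pt_sub_pt] at h1
  have : (ldist (Plane.site p) f : ℝ) ≤ 20 := by exact_mod_cast hle
  linarith

/-- **Gap points have free sites**: neither in `J` nor outer. [cite: Hochman2025, §6.2] -/
theorem site_free_of_gap (hJ : J.Nonempty) {p : ℂ} (h : p ∈ Gap J) :
    Plane.site p ∉ J ∧ Plane.site p ∉ Outer 20 J := by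
  have h' : β J p = 21 / 2 := h
  exact ⟨site_not_mem_of_β_lt hJ (by rw [h']; norm_num), site_not_mem_outer_of_one_le_β (by rw [h']; norm_num)⟩

/-- **`1 ≤ α p` ⇒ the site of `p` is outer.** [cite: Hochman2025, §6.2] -/
theorem site_mem_outer_of_one_le_α {p : ℂ} (h : 1 ≤ α J p) : Plane.site p ∈ Outer 20 J := by
  by_contra hn
  exact site_notMem_of_one_le_sdist h hn

/-- `1 ≤ α p` ⇒ `β p < 1` (deep `x`-points are in the `x`-zone). [folklore] -/
theorem β_lt_one_of_one_le_α {p : ℂ} (h : 1 ≤ α J p) : β J p < 1 :=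
  sdist_lt_one_of_site_mem (site_mem_outer_of_one_le_α h)

/-- `1 ≤ β p` ⇒ `α p < 1`. [folklore] -/
theorem α_lt_one_of_one_le_β {p : ℂ} (h : 1 ≤ β J p) : α J p < 1 :=
  sdist_lt_one_of_site_mem (show Plane.site p ∈ (Outer 20 J)ᶜ from site_not_mem_outer_of_one_le_β h)

/-- Points within sup-distance `10` of a site of `J` have `β ≥ 11` (they are in the `y`-zone).
[cite: Hochman2025, §6.2] -/
theorem le_β_of_near_mem (hJ : J.Nonempty) {p : ℂ} {f : ℤ × ℤ} (hf : f ∈ J)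
    (h : supNorm (p - pt f) ≤ 10) : 11 ≤ β J p := by
  apply le_sdist (outer_nonempty hJ)
  intro o ho
  have h1 := ldist_ge_of_outer ho hf
  have h2 : (21 : ℝ) ≤ supNorm (pt o - pt f) := by rw [supNorm_pt_sub_pt]; exact_mod_cast h1
  have h3 := supNorm_sub_le (pt o) p (pt f)
  rw [supNorm_sub_comm (pt o) p] at h3
  linarith

/-- Points within sup-distance `10` of an outer site have `β ≤ 10` (they are in the `x`-zone).
[cite: Hochman2025, §6.2] -/
theorem β_le_of_near_outer {p : ℂ} {o : ℤ × ℤ} (ho : o ∈ Outer 20 J) (h : supNorm (p - pt o) ≤ 10) :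
    β J p ≤ 10 :=
  le_trans (sdist_le ho) h

/-- **Deep points of the two zones are far apart**: `α p ≥ t` and `β q ≥ t` force
`‖p - q‖ > 2t - 2` (all sites within `t - 1` of `p` are outer, all within `t - 1` of `q` are
not). [cite: Hochman2025, §6.3 Step A ("its total length is greater than `4/3 rₙ`")] -/
theorem norm_sub_gt_of_α_β {p q : ℂ} {t : ℝ} (hp : t ≤ α J p) (hq : t ≤ β J q) :
    2 * t - 2 < ‖p - q‖ := by
  by_contra hle
  push Not at hle
  have hsup : supNorm (p - q) ≤ 2 * t - 2 := le_trans (supNorm_le_norm _) hle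
  -- the site of the midpoint is within `< t` of both `p` and `q`
  set m : ℂ := p + ((1 / 2 : ℝ) : ℂ) * (q - p) with hm
  set u := Plane.site m with hu
  have hpm : supNorm (p - m) ≤ t - 1 := by
    have : p - m = (((-(1 / 2) : ℝ)) : ℂ) * (q - p) := by rw [hm]; push_cast; ring
    rw [this, supNorm_real_smul, supNorm_sub_comm]
    rw [show |(-(1 / 2) : ℝ)| = 1 / 2 by norm_num]
    linarith
  have hqm : supNorm (q - m) ≤ t - 1 := by
    have : q - m = (((1 / 2 : ℝ)) : ℂ) * (q - p) := by rw [hm]; push_cast; ring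
    rw [this, supNorm_real_smul, supNorm_sub_comm]
    rw [show |((1 / 2) : ℝ)| = 1 / 2 by norm_num]
    linarith
  have hmu := supNorm_sub_site_lt m
  have hpu : supNorm (p - pt u) < t := by
    have := supNorm_sub_le p m (pt u); linarith
  have hqu : supNorm (q - pt u) < t := by
    have := supNorm_sub_le q m (pt u); linarith
  by_cases huo : u ∈ Outer 20 J
  · have := sdist_le (A := Outer 20 J) (p := q) huo
    change β J q ≤ _ at this
    linarith
  · have := sdist_le (A := (Outer 20 J)ᶜ) (p := p) huo
    change α J p ≤ _ at this
    linarith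

/-! ### Polylines of chains -/

/-- The broken line through the points of a list of sites. [folklore] -/
def polyline : List (ℤ × ℤ) → Set ℂ
  | [] => ∅
  | [a] => {pt a}
  | a :: b :: l => segment ℝ (pt a) (pt b) ∪ polyline (b :: l)

/-- The polyline of `a :: l` contains `pt a`. [folklore] -/
theorem pt_head_mem_polyline (a : ℤ × ℤ) (l : List (ℤ × ℤ)) : pt a ∈ polyline (a :: l) := by
  cases l with
  | nil => simp [polyline]
  | cons b l => exact Or.inl (left_mem_segment ℝ _ _)

/-- The polyline contains the points of all sites of the list. [folklore] -/
theorem pt_mem_polyline {l : List (ℤ × ℤ)} {a : ℤ × ℤ} (ha : a ∈ l) : pt a ∈ polyline l := by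
  induction l with
  | nil => simp at ha
  | cons b l ih =>
    rcases List.mem_cons.mp ha with rfl | ha
    · exact pt_head_mem_polyline _ _
    · cases l with
      | nil => simp at ha
      | cons c l => exact Or.inr (ih ha)

/-- Polylines are preconnected. [folklore] -/
theorem isPreconnected_polyline : ∀ l : List (ℤ × ℤ), IsPreconnected (polyline l)
  | [] => isPreconnected_empty
  | [a] => isPreconnected_singleton
  | a :: b :: l => by
    change IsPreconnected (segment ℝ (pt a) (pt b) ∪ polyline (b :: l))
    exact IsPreconnected.union (pt b) (right_mem_segment ℝ _ _) (pt_head_mem_polyline b l)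
      (convex_segment _ _).isPreconnected (isPreconnected_polyline (b :: l))

/-- A point of a segment between sites at lattice distance `≤ g` is within sup-distance `g/2`
of one of them. [folklore] -/
theorem exists_near_of_mem_segment {a b : ℤ × ℤ} {g : ℕ} (hab : ldist a b ≤ g) {p : ℂ}
    (hp : p ∈ segment ℝ (pt a) (pt b)) :
    supNorm (p - pt a) ≤ g / 2 ∨ supNorm (p - pt b) ≤ g / 2 := by
  obtain ⟨s, t, hs, ht, hst, rfl⟩ := hp
  have hd : supNorm (pt b - pt a) ≤ g := by
    rw [supNorm_pt_sub_pt, ldist_comm]; exact_mod_cast hab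
  have e1 : s • pt a + t • pt b - pt a = ((t : ℝ) : ℂ) * (pt b - pt a) := by
    have : (s : ℂ) = 1 - t := by
      have : (s : ℝ) = 1 - t := by linarith
      rw [this]; push_cast; ring
    simp only [Complex.real_smul]
    rw [this]; ring
  have e2 : s • pt a + t • pt b - pt b = ((-s : ℝ) : ℂ) * (pt b - pt a) := by
    have : (t : ℂ) = 1 - s := by
      have : (t : ℝ) = 1 - s := by linarith
      rw [this]; push_cast; ring
    simp only [Complex.real_smul]
    rw [this]; push_cast; ring
  rcases le_total t (1 / 2) with h | h
  · left
    rw [e1, supNorm_real_smul, abs_of_nonneg ht]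
    have := supNorm_nonneg (pt b - pt a)
    nlinarith
  · right
    rw [e2, supNorm_real_smul, abs_neg, abs_of_nonneg hs]
    have := supNorm_nonneg (pt b - pt a)
    have hs' : s ≤ 1 / 2 := by linarith
    nlinarith

/-- **Points of the polyline of a `g`-chain are within sup-distance `g/2` of the chain.**
[folklore] -/
theorem exists_near_of_mem_polyline {g : ℕ} :
    ∀ {l : List (ℤ × ℤ)}, List.IsChain (fun a b => ldist a b ≤ g) l →
      ∀ {p : ℂ}, p ∈ polyline l → ∃ a ∈ l, supNorm (p - pt a) ≤ g / 2
  | [], _, p, hp => by simp [polyline] at hp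
  | [a], _, p, hp => by
    simp only [polyline, mem_singleton_iff] at hp
    subst hp
    exact ⟨a, by simp, by simp; positivity⟩
  | a :: b :: l, hch, p, hp => by
    rw [List.isChain_cons_cons] at hch
    rcases hp with hp | hp
    · rcases exists_near_of_mem_segment hch.1 hp with h | h
      · exact ⟨a, by simp, h⟩
      · exact ⟨b, by simp, h⟩
    · obtain ⟨c, hc, h⟩ := exists_near_of_mem_polyline hch.2 hp
      exact ⟨c, List.mem_cons_of_mem _ hc, h⟩

/-- A chain for `ChainRel g S` is a chain for `ldist ≤ g`. [folklore] -/
theorem isChain_ldist_of_isChain_chainRel {g : ℕ} {S : Set (ℤ × ℤ)} {l : List (ℤ × ℤ)}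
    (h : List.IsChain (ChainRel g S) l) : List.IsChain (fun a b => ldist a b ≤ g) l :=
  List.IsChain.imp (fun a b hab => (dist_le_iff g a b).mp hab.2.2) h

/-- The polyline of a `20`-chain of outer sites lies in the `x`-zone `U`. [cite: Hochman2025, §6.2] -/
theorem polyline_subset_U {l : List (ℤ × ℤ)} (hch : List.IsChain (fun a b => ldist a b ≤ 20) l)
    (hout : ∀ a ∈ l, a ∈ Outer 20 J) : polyline l ⊆ U J := by
  intro p hp
  obtain ⟨a, ha, hnear⟩ := exists_near_of_mem_polyline hch hp
  have := β_le_of_near_outer (hout a ha) (by norm_num at hnear; linarith)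
  show β J p < 21 / 2
  linarith

/-- The polyline of a `20`-chain of sites of `J` lies in the `y`-zone `V`. [cite: Hochman2025, §6.2] -/
theorem polyline_subset_V (hJ : J.Nonempty) {l : List (ℤ × ℤ)}
    (hch : List.IsChain (fun a b => ldist a b ≤ 20) l) (hmem : ∀ a ∈ l, a ∈ J) :
    polyline l ⊆ V J := by
  intro p hp
  obtain ⟨a, ha, hnear⟩ := exists_near_of_mem_polyline hch hp
  have := le_β_of_near_mem hJ (hmem a ha) (by norm_num at hnear; linarith)
  show 21 / 2 < β J p
  linarith

/-! ### Reach of the two zones -/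

/-- Points to the left of an escaping site are in the `x`-zone (their sites escape).
[folklore] -/
theorem β_lt_one_of_left_of_escapes {u' : ℤ × ℤ} (hu' : Escapes 20 J u') {p : ℂ}
    (hre : p.re ≤ u'.1) : β J p < 1 := by
  have hesc : Escapes 20 J (Plane.site p) := by
    intro q hq
    have h1 := hu' q hq
    have h2 : (⌊p.re⌋ : ℝ) ≤ p.re := Int.floor_le _
    have h3 : ((Plane.site p).1 : ℝ) ≤ u'.1 := le_trans h2 hre
    have h4 : (Plane.site p).1 ≤ u'.1 := by exact_mod_cast h3
    push_cast; omega
  exact sdist_lt_one_of_site_mem hesc.mem_outer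

/-- **Reach of the `x`-zone**: from every outer site a preconnected subset of `U` reaches
arbitrarily far (the polyline of its chain to an escaping site, continued to the left).
[cite: Hochman2025, §6.2 (`E_x` is the unbounded component)] -/
theorem exists_U_reach {o : ℤ × ℤ} (ho : o ∈ Outer 20 J) (R : ℝ) :
    ∃ S ⊆ U J, IsPreconnected S ∧ pt o ∈ S ∧ ∃ q ∈ S, R < ‖q - pt o‖ := by
  obtain ⟨u', hu', hch⟩ := ho
  obtain ⟨l, hl, hlast⟩ := List.exists_isChain_cons_of_relationReflTransGen hch
  -- all sites of the chain are outer
  have hout : ∀ a ∈ o :: l, a ∈ Outer 20 J :=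
    List.IsChain.backwards_cons_induction (p := fun a => a ∈ Outer 20 J) l hl hlast
      (fun x y hxy hy => mem_outer_of_reflTransGen (Relation.ReflTransGen.single hxy) hy)
      hu'.mem_outer
  have hch' := isChain_ldist_of_isChain_chainRel hl
  -- the leftward segment from `pt u'`
  set K : ℕ := ⌈|R|⌉₊ + (u'.1 - o.1).natAbs + 1 with hK
  set u'' : ℤ × ℤ := (u'.1 - K, u'.2) with hu''
  set S : Set ℂ := polyline (o :: l) ∪ segment ℝ (pt u') (pt u'') with hS
  have hu'mem : pt u' ∈ polyline (o :: l) := by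
    have : u' ∈ o :: l := by rw [← hlast]; exact List.getLast_mem _
    exact pt_mem_polyline this
  refine ⟨S, ?_, ?_, Or.inl (pt_head_mem_polyline o l), pt u'', Or.inr (right_mem_segment ℝ _ _), ?_⟩
  · rintro p (hp | hp)
    · exact polyline_subset_U hch' hout hp
    · -- on the segment: real part `≤ u'.1`, imaginary part `= u'.2`
      obtain ⟨s, t, hs, ht, hst, rfl⟩ := hp
      show β J _ < 21 / 2
      have hre : (s • pt u' + t • pt u'').re ≤ u'.1 := by
        simp only [Complex.add_re, Complex.real_smul, Complex.re_ofReal_mul, pt_re, hu'']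
        push_cast
        have hs' : s = 1 - t := by linarith
        rw [hs']
        have h0 : (0 : ℝ) ≤ t * K := mul_nonneg ht (Nat.cast_nonneg K)
        have e : (1 - t) * (u'.1 : ℝ) + t * ((u'.1 : ℝ) - K) = u'.1 - t * K := by ring
        linarith
      have := β_lt_one_of_left_of_escapes hu' hre
      linarith
  · exact IsPreconnected.union (pt u') hu'mem (left_mem_segment ℝ _ _) (isPreconnected_polyline _)
      (convex_segment _ _).isPreconnected
  · have h1 : |(pt u'' - pt o).re| ≤ ‖pt u'' - pt o‖ := Complex.abs_re_le_norm _
    simp only [Complex.sub_re, pt_re, hu''] at h1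
    push_cast at h1
    have hK' : (K : ℝ) = ⌈|R|⌉₊ + ((u'.1 - o.1).natAbs : ℝ) + 1 := by rw [hK]; push_cast; ring
    have h2 : |R| ≤ ⌈|R|⌉₊ := Nat.le_ceil _
    have h3 : |((u'.1 : ℝ) - o.1)| = ((u'.1 - o.1).natAbs : ℝ) := by
      rw [Nat.cast_natAbs]; push_cast; rfl
    have h4 := le_abs_self R
    have h5 : (K : ℝ) - |((u'.1 : ℝ) - o.1)| ≤ |((u'.1 : ℝ) - K - o.1)| := by
      have := abs_sub_abs_le_abs_sub ((u'.1 : ℝ) - K - o.1 + -((u'.1 : ℝ) - o.1)) (-((u'.1 : ℝ) - o.1))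
      rw [abs_neg] at this
      have e : (u'.1 : ℝ) - K - o.1 + -((u'.1 : ℝ) - o.1) - -((u'.1 : ℝ) - o.1) = (u'.1 : ℝ) - K - o.1 := by ring
      rw [e] at this
      have e2 : |(u'.1 : ℝ) - K - o.1 + -((u'.1 : ℝ) - o.1)| = K := by
        rw [show (u'.1 : ℝ) - K - o.1 + -((u'.1 : ℝ) - o.1) = -(K : ℝ) by ring, abs_neg, abs_of_nonneg (by positivity)]
      linarith
    linarith

/-- The diameter of a non-empty finite set of sites is attained. [folklore] -/
theorem exists_ldist_eq_ldiam (hJ : J.Nonempty) : ∃ a ∈ J, ∃ b ∈ J, ldist a b = ldiam J := by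
  obtain ⟨a, ha, ha'⟩ := Finset.exists_mem_eq_sup J hJ (fun p => J.sup fun q => ldist p q)
  obtain ⟨b, hb, hb'⟩ := Finset.exists_mem_eq_sup J hJ (fun q => ldist a q)
  exact ⟨a, ha, b, hb, by rw [ldiam, ha', hb']⟩

/-- From every site some site of `J` is at lattice distance `≥ diam(J)/2`. [folklore] -/
theorem exists_far_mem (hJ : J.Nonempty) (f : ℤ × ℤ) :
    ∃ f' ∈ J, ldiam J ≤ 2 * ldist f f' := by
  obtain ⟨a, ha, b, hb, hab⟩ := exists_ldist_eq_ldiam hJ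
  have htri := ldist_triangle a f b
  rw [ldist_comm a f] at htri
  by_cases h : ldiam J ≤ 2 * ldist f a
  · exact ⟨a, ha, h⟩
  · exact ⟨b, hb, by omega⟩

/-- **Reach of the `y`-zone**: from every site of the `20`-chain-connected set `J` a
preconnected subset of `V` (the polyline of a chain in `J`) reaches distance `≥ diam(J)/2`.
[cite: Hochman2025, §6.2] -/
theorem exists_V_reach (hJ : J.Nonempty)
    (hJc : ∀ p ∈ J, ∀ q ∈ J, Relation.ReflTransGen (ChainRel 20 (↑J : Set (ℤ × ℤ))) p q)
    {f : ℤ × ℤ} (hf : f ∈ J) :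
    ∃ S ⊆ V J, IsPreconnected S ∧ pt f ∈ S ∧ ∃ q ∈ S, (ldiam J : ℝ) / 2 ≤ ‖q - pt f‖ := by
  obtain ⟨f', hf', hfar⟩ := exists_far_mem hJ f
  obtain ⟨l, hl, hlast⟩ := List.exists_isChain_cons_of_relationReflTransGen (hJc f hf f' hf')
  have hmem : ∀ a ∈ f :: l, a ∈ J := by
    intro a ha
    rcases List.mem_cons.mp ha with rfl | ha
    · exact hf
    · exact List.IsChain.cons_induction (p := fun a => a ∈ J) l hl
        (fun x y hxy _ => Finset.mem_coe.mp hxy.2.1) hf a ha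
  have hch' := isChain_ldist_of_isChain_chainRel hl
  refine ⟨polyline (f :: l), polyline_subset_V hJ hch' hmem, isPreconnected_polyline _,
    pt_head_mem_polyline f l, pt f', ?_, ?_⟩
  · have : f' ∈ f :: l := by rw [← hlast]; exact List.getLast_mem _
    exact pt_mem_polyline this
  · have h1 := supNorm_le_norm (pt f' - pt f)
    rw [supNorm_pt_sub_pt, ldist_comm] at h1
    have h2 : (ldiam J : ℝ) ≤ 2 * ldist f f' := by exact_mod_cast hfar
    linarith

/-! ### Large gap continua around every gap point (§6.3 Step C, made rigorous) -/

/-- **Around every gap point the gap contains a large continuum.** If `J` is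
`20`-chain-connected with `diam J ≥ 2R + 130` (`R > 50`), then for every point `e` of the gap
there is a compact connected subset of the gap inside the annulus `50 ≤ |z - e| ≤ R` meeting
both circles. (Membrane lemma applied to the zones: the `x`-zone reaches from an outer site
within `22` of `e` to infinity, the `y`-zone from a site of `J` within `42` of `e` to distance
`diam(J)/2`.) [cite: Hochman2025, §6.3 Step C ("`Ê ∩ F` has a connected component `Ê′` with
diameter at least `rₙ/10`")] -/
theorem exists_gap_continuum (hJ : J.Nonempty)
    (hJc : ∀ p ∈ J, ∀ q ∈ J, Relation.ReflTransGen (ChainRel 20 (↑J : Set (ℤ × ℤ))) p q)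
    {e : ℂ} (he : e ∈ Gap J) {R : ℝ} (hR : 50 < R) (hdiam : 2 * R + 130 ≤ (ldiam J : ℝ)) :
    ∃ P ⊆ Gap J, IsCompact P ∧ IsPreconnected P ∧ (∀ p ∈ P, 50 ≤ dist p e ∧ dist p e ≤ R) ∧
      (∃ p ∈ P, dist p e = 50) ∧ ∃ q ∈ P, dist q e = R := by
  have he' : β J e = 21 / 2 := he
  -- the `x`-side: an outer site within sup-distance `11` of `e`
  obtain ⟨o, ho, holt⟩ := exists_lt_of_sdist_lt (outer_nonempty hJ) (show β J e < 11 by rw [he']; norm_num)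
  have hoe : dist (pt o) e < 22 := by
    rw [Complex.dist_eq, ← norm_neg, neg_sub]
    have := norm_le_two_mul_supNorm (e - pt o); linarith
  obtain ⟨SU, hSU, hSUc, hoSU, qU, hqU, hqUfar⟩ := exists_U_reach (J := J) ho (R + 22)
  -- the `y`-side: a site of `J` within sup-distance `21` of `e`
  obtain ⟨f, hf, hflt⟩ := exists_mem_near_of_β hJ (by rw [he']; norm_num) (by rw [he']; norm_num)
  have hfe : dist (pt f) e < 42 := by
    rw [Complex.dist_eq, ← norm_neg, neg_sub]
    have := norm_le_two_mul_supNorm (e - pt f); linarith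
  obtain ⟨SV, hSV, hSVc, hfSV, qV, hqV, hqVfar⟩ := exists_V_reach hJ hJc hf
  obtain ⟨P, hP, hPc, hPconn, hPann, hP0, hP1⟩ :=
    exists_continuum_compl_annulus (isOpen_U hJ) (isOpen_V hJ) disjoint_U_V (by norm_num : (0:ℝ) < 50) hR
      ⟨SU, hSU, hSUc, ⟨pt o, hoSU, by linarith⟩, qU, hqU, by
        have := dist_triangle qU (pt o) e
        rw [Complex.dist_eq qU (pt o)] at this
        have h2 : dist qU e ≥ ‖qU - pt o‖ - dist (pt o) e := by
          have := dist_triangle qU e (pt o); rw [Complex.dist_eq qU (pt o)] at *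
          have := dist_comm e (pt o); linarith
        linarith⟩
      ⟨SV, hSV, hSVc, ⟨pt f, hfSV, by linarith⟩, qV, hqV, by
        have h2 : dist qV e ≥ ‖qV - pt f‖ - dist (pt f) e := by
          have := dist_triangle qV e (pt f); rw [Complex.dist_eq qV (pt f)] at *
          have := dist_comm e (pt f); linarith
        linarith⟩
  refine ⟨P, ?_, hPc, hPconn, hPann, hP0, hP1⟩
  rw [compl_U_union_V] at hP
  exact hP

end Gluing

end Hochman2025

end Literature.Dynamics.SymbolicDynamics
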